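import Mathlib.Analysis.Matrix.Normed
import Literature.Barriers.MatrixMultiplication.QuasirandomBarrierProofs
import Literature.RepresentationTheory.FiniteGroups.FourierInversionIdentity
import Literature.RepresentationTheory.FiniteGroups.UnitaryWedderburn
import Literature.Combinatorics.Additive.TPPGroupAlgebra
import Literature.MathematicalPhysics.QuantumLattice.TracePowerInequalities

/-!
# `SnSubsetDichotomy.GlobalBranch`, line `bregman-entropy-window` — stub `slackPacking`

Registered stub `slackPacking` of crux `stmt-MatrixMultiplication-8303`
(`Summit.MatrixMultiplication.MatrixMultiplication.Theses.SnSubsetDichotomy.GlobalBranch`), line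
`bregman-entropy-window`: the **slack form** of the quasirandom packing bound of
Blasiak–Cohn–Grochow–Pratt–Umans 2023, Thm. 3.2.  For a TPP triple `S, T, U` of a finite group `G`,
with `N = |S||T||U|`, `a = |S||T|`, `b = |T||U|`, `c = |U||S|` and `n = n(G)` the second-smallest
character degree (`secondCharDegree`),

  `√n · (N − |G|) ≤ √((|G| − a)(|G| − b)(|G| − c))`.

The proof is the tree's proof of Thm. 3.2 (`BCGPU2023_thm32_holds`,
`Literature/Barriers/MatrixMultiplication/QuasirandomBarrierProofs.lean`) with ONE change: before
bounding the blocks of dimension `dᵢ > 1` by Parseval, the trivial block `i₀` is removed from the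
Parseval sums.  On a unitary Wedderburn decomposition `φ` with `Aᵢ = φ(𝟙_{S⁻¹}𝟙_T)ᵢ`,
`Bᵢ = φ(𝟙_{T⁻¹}𝟙_U)ᵢ`, `Cᵢ = φ(𝟙_{U⁻¹}𝟙_S)ᵢ`:
1. `|G| N = ∑ᵢ dᵢ Re tr(Aᵢ Bᵢ Cᵢ)` (Fourier inversion at `1` and the TPP count);
2. `∑ᵢ dᵢ ‖Aᵢ‖²_F = |G| a` and cyclically (Parseval);
3. the trivial block contributes `N²` to (1) and `a²` to (2) (`A_{i₀} = a · 1` as a `1 × 1`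
   matrix), the other blocks of dimension `1` contribute `≥ 0` to both;
4. hence `∑_{dᵢ ≠ 1} dᵢ ‖Aᵢ‖²_F ≤ |G| a − a² = a(|G| − a)` and, for `dᵢ > 1`,
   `‖Aᵢ‖²_F ≤ a(|G| − a)/n`; with `dᵢ |tr(Aᵢ Bᵢ Cᵢ)| ≤ dᵢ ‖Aᵢ‖ ‖Bᵢ‖ ‖Cᵢ‖` and Cauchy–Schwarz
   over the blocks with `dᵢ ≠ 1`,
   `∑_{dᵢ ≠ 1} dᵢ |tr(Aᵢ Bᵢ Cᵢ)| ≤ E := √(a(|G|−a)/n) · √(b(|G|−b)) · √(c(|G|−c))`;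
5. so `N² − E ≤ |G| N`, and `√n · E = √(a(|G|−a) b(|G|−b) c(|G|−c)) = N √((|G|−a)(|G|−b)(|G|−c))`
   (`abc = N²`); cancelling `N > 0` gives the claim.
Degenerate cases: a set empty (`N = 0`, left side `≤ 0`); `n = 0` (no block of dimension `> 1`,
left side `= 0`).
-/

-- `Summit.<Summit>.<Problem>` is the tree's mandated summit-side namespace; for this
-- single-conjunct summit the two coincide, so the file silences `dupNamespace`.
set_option linter.dupNamespace false
set_option autoImplicit false

noncomputable section

open scoped BigOperators Matrix ComplexOrder

namespace Summit.MatrixMultiplication.MatrixMultiplication.Theorems.GlobalBranch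

open Literature.Combinatorics.Additive Literature.Barriers.MatrixMultiplication
open Literature.RepresentationTheory.FiniteGroups

/-- **Stub `slackPacking` (slack form of BCGPU 2023, Thm. 3.2).**  If `S, T, U` satisfy the triple
product property in a finite group `G` then, with `N = |S||T||U|` and `n = n(G)` the
second-smallest character degree,
`√n · (N − |G|) ≤ √((|G| − |S||T|)(|G| − |T||U|)(|G| − |U||S|))`.
Why: in the Fourier proof of Thm. 3.2 the trivial block contributes exactly `(|S||T|)²` to the
Parseval sum `∑ᵢ dᵢ‖φ(𝟙_{S⁻¹}𝟙_T)ᵢ‖²_F = |G||S||T|` (and cyclically), so the blocks of dimension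
`> 1` only carry `|S||T|(|G| − |S||T|)`; the rest of the argument (trace Cauchy–Schwarz on each
block, Cauchy–Schwarz over the blocks, `N² − E ≤ |G|N`) is unchanged.
[cite: BlasiakCohnGrochowPrattUmans2023, Thm. 3.2 (proof)] -/
theorem slackPacking : ∀ (G : Type) [Group G] [Fintype G] (S T U : Finset G),
    TripleProductProperty S T U →
    Real.sqrt (secondCharDegree G : ℝ) *
        (((S.card * T.card * U.card : ℕ) : ℝ) - (Fintype.card G : ℝ)) ≤
      Real.sqrt (((Fintype.card G : ℝ) - (S.card : ℝ) * (T.card : ℝ)) *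
        ((Fintype.card G : ℝ) - (T.card : ℝ) * (U.card : ℝ)) *
        ((Fintype.card G : ℝ) - (U.card : ℝ) * (S.card : ℝ))) := by
  intro G _ _ S T U hTPP
  classical
  -- degenerate case: one of the sets is empty (`N = 0`, the left side is `≤ 0`)
  by_cases hN0 : S.card * T.card * U.card = 0
  · rw [hN0, Nat.cast_zero, zero_sub]
    exact (mul_nonpos_of_nonneg_of_nonpos (Real.sqrt_nonneg _)
      (neg_nonpos.2 (Nat.cast_nonneg _))).trans (Real.sqrt_nonneg _)
  have hS : S.Nonempty := Finset.card_ne_zero.1 fun h => hN0 (by simp [h])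
  have hT : T.Nonempty := Finset.card_ne_zero.1 fun h => hN0 (by simp [h])
  have hU : U.Nonempty := Finset.card_ne_zero.1 fun h => hN0 (by simp [h])
  -- a unitary Wedderburn decomposition and its trivial block
  obtain ⟨r, d, hd, φ, hφ⟩ := exists_unitary_algEquiv_pi_matrix G
  obtain ⟨i₀, hdi₀, hφi₀⟩ := exists_trivial_block φ
  -- notation
  set N : ℕ := S.card * T.card * U.card with hN
  set cG : ℝ := (Fintype.card G : ℝ) with hcG
  set n : ℝ := (secondCharDegree G : ℝ) with hn
  set a : ∀ i : Fin r, Matrix (Fin (d i)) (Fin (d i)) ℂ := fun i => φ (indicatorElem ℂ S) i with ha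
  set t : ∀ i : Fin r, Matrix (Fin (d i)) (Fin (d i)) ℂ := fun i => φ (indicatorElem ℂ T) i with ht
  set u : ∀ i : Fin r, Matrix (Fin (d i)) (Fin (d i)) ℂ := fun i => φ (indicatorElem ℂ U) i with hu
  set A : ∀ i : Fin r, Matrix (Fin (d i)) (Fin (d i)) ℂ := fun i => (a i)ᴴ * t i with hA
  set B : ∀ i : Fin r, Matrix (Fin (d i)) (Fin (d i)) ℂ := fun i => (t i)ᴴ * u i with hB
  set C : ∀ i : Fin r, Matrix (Fin (d i)) (Fin (d i)) ℂ := fun i => (u i)ᴴ * a i with hC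
  have hPA : ∀ i, φ (indicatorElemInv ℂ S * indicatorElem ℂ T) i = A i := fun i => by
    rw [map_mul, Pi.mul_apply, algEquiv_indicatorElemInv_eq_conjTranspose φ hφ]
  have hQB : ∀ i, φ (indicatorElemInv ℂ T * indicatorElem ℂ U) i = B i := fun i => by
    rw [map_mul, Pi.mul_apply, algEquiv_indicatorElemInv_eq_conjTranspose φ hφ]
  have hRC : ∀ i, φ (indicatorElemInv ℂ U * indicatorElem ℂ S) i = C i := fun i => by
    rw [map_mul, Pi.mul_apply, algEquiv_indicatorElemInv_eq_conjTranspose φ hφ]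
  -- (1) Fourier inversion at `1` + TPP count: `|G| N = ∑ dᵢ tr(Aᵢ Bᵢ Cᵢ)`
  have h1 : (cG * N : ℝ) = ∑ i, (d i : ℝ) * (A i * B i * C i).trace.re := by
    have h := card_mul_coeff_one_eq_sum_trace φ
      ((indicatorElemInv ℂ S * indicatorElem ℂ T) * (indicatorElemInv ℂ T * indicatorElem ℂ U) *
        (indicatorElemInv ℂ U * indicatorElem ℂ S))
    rw [hTPP.coeff_one_six] at h
    simp only [map_mul, Pi.mul_apply] at h
    simp only [map_mul, Pi.mul_apply] at hPA hQB hRC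
    simp only [hPA, hQB, hRC] at h
    have h' := congrArg Complex.re h
    rw [Complex.re_sum] at h'
    simpa [hcG, hN] using h'
  -- (2) Parseval: `∑ dᵢ ‖Aᵢ‖² = |G||S||T|` and cyclically
  have h2A : ∑ i, (d i : ℝ) * ((A i)ᴴ * A i).trace.re = cG * (S.card * T.card) := by
    have h := parseval_of_adjoint φ (indicatorElemInv ℂ S * indicatorElem ℂ T)
      (indicatorElemInv ℂ T * indicatorElem ℂ S) fun i => by
      rw [hPA, map_mul, Pi.mul_apply, algEquiv_indicatorElemInv_eq_conjTranspose φ hφ, hA]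
      simp only [Matrix.conjTranspose_mul, Matrix.conjTranspose_conjTranspose]
      rfl
    rw [hTPP.coeff_one_four hU] at h
    simp only [hPA] at h
    rw [hcG]
    exact_mod_cast h
  have h2B : ∑ i, (d i : ℝ) * ((B i)ᴴ * B i).trace.re = cG * (T.card * U.card) := by
    have h := parseval_of_adjoint φ (indicatorElemInv ℂ T * indicatorElem ℂ U)
      (indicatorElemInv ℂ U * indicatorElem ℂ T) fun i => by
      rw [hQB, map_mul, Pi.mul_apply, algEquiv_indicatorElemInv_eq_conjTranspose φ hφ, hB]
      simp only [Matrix.conjTranspose_mul, Matrix.conjTranspose_conjTranspose]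
      rfl
    rw [hTPP.rotate.coeff_one_four hS] at h
    simp only [hQB] at h
    rw [hcG]
    exact_mod_cast h
  have h2C : ∑ i, (d i : ℝ) * ((C i)ᴴ * C i).trace.re = cG * (U.card * S.card) := by
    have h := parseval_of_adjoint φ (indicatorElemInv ℂ U * indicatorElem ℂ S)
      (indicatorElemInv ℂ S * indicatorElem ℂ U) fun i => by
      rw [hRC, map_mul, Pi.mul_apply, algEquiv_indicatorElemInv_eq_conjTranspose φ hφ, hC]
      simp only [Matrix.conjTranspose_mul, Matrix.conjTranspose_conjTranspose]
      rfl
    rw [hTPP.rotate.rotate.coeff_one_four hT] at h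
    simp only [hRC] at h
    rw [hcG]
    exact_mod_cast h
  -- (3) the trivial block contributes `N²` to (1) and `a², b², c²` to the Parseval sums
  have hind : ∀ X : Finset G,
      φ (indicatorElem ℂ X) i₀ = (X.card : ℂ) • (1 : Matrix _ _ ℂ) := fun X => by
    rw [indicatorElem_def, map_sum, Finset.sum_apply]
    simp only [hφi₀, Finset.sum_const, Nat.cast_smul_eq_nsmul]
  have h3 : (d i₀ : ℝ) * (A i₀ * B i₀ * C i₀).trace.re = (N : ℝ) ^ 2 := by
    simp only [hA, hB, hC, ha, ht, hu, hind, Matrix.conjTranspose_smul, Matrix.conjTranspose_one,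
      Matrix.smul_mul, Matrix.mul_smul, Matrix.one_mul, smul_smul, Matrix.trace_smul,
      Matrix.trace_one, Fintype.card_fin, hdi₀, hN]
    simp
    ring
  have h3A : (d i₀ : ℝ) * ((A i₀)ᴴ * A i₀).trace.re = ((S.card : ℝ) * T.card) ^ 2 := by
    simp only [hA, ha, ht, hind, Matrix.conjTranspose_smul, Matrix.conjTranspose_one,
      Matrix.smul_mul, Matrix.mul_smul, Matrix.one_mul, smul_smul, Matrix.trace_smul,
      Matrix.trace_one, Fintype.card_fin, hdi₀]
    simp
    ring
  have h3B : (d i₀ : ℝ) * ((B i₀)ᴴ * B i₀).trace.re = ((T.card : ℝ) * U.card) ^ 2 := by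
    simp only [hB, ht, hu, hind, Matrix.conjTranspose_smul, Matrix.conjTranspose_one,
      Matrix.smul_mul, Matrix.mul_smul, Matrix.one_mul, smul_smul, Matrix.trace_smul,
      Matrix.trace_one, Fintype.card_fin, hdi₀]
    simp
    ring
  have h3C : (d i₀ : ℝ) * ((C i₀)ᴴ * C i₀).trace.re = ((U.card : ℝ) * S.card) ^ 2 := by
    simp only [hC, hu, ha, hind, Matrix.conjTranspose_smul, Matrix.conjTranspose_one,
      Matrix.smul_mul, Matrix.mul_smul, Matrix.one_mul, smul_smul, Matrix.trace_smul,
      Matrix.trace_one, Fintype.card_fin, hdi₀]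
    simp
    ring
  -- (4) blocks of dimension `1` contribute non-negative reals
  have h4 : ∀ i, d i = 1 → 0 ≤ (d i : ℝ) * (A i * B i * C i).trace.re := by
    intro i hi
    haveI : Subsingleton (Fin (d i)) := by rw [hi]; infer_instance
    exact mul_nonneg (Nat.cast_nonneg _) (trace_cyclic_nonneg_of_subsingleton (a i) (t i) (u i))
  -- Parseval minus the trivial block: `∑_{dᵢ ≠ 1} dᵢ ‖Aᵢ‖² ≤ |G| a − a²`, and cyclically
  have hrest : ∀ (f : Fin r → ℝ) (x y : ℝ), (∀ i, 0 ≤ f i) → ∑ i, f i = x → y ≤ f i₀ →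
      ∑ i ∈ Finset.univ.filter (fun i => ¬ d i = 1), f i ≤ x - y := by
    intro f x y hf hsum hy
    have hsplit := Finset.sum_filter_add_sum_filter_not Finset.univ (fun i => d i = 1) f
    have hpos : y ≤ ∑ i ∈ Finset.univ.filter (fun i => d i = 1), f i :=
      hy.trans (Finset.single_le_sum (f := f) (fun i _ => hf i)
        (Finset.mem_filter.2 ⟨Finset.mem_univ _, hdi₀⟩))
    linarith
  have hFA : ∑ i ∈ Finset.univ.filter (fun i => ¬ d i = 1), (d i : ℝ) * ((A i)ᴴ * A i).trace.re ≤
      cG * (S.card * T.card) - ((S.card : ℝ) * T.card) ^ 2 :=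
    hrest (fun i => (d i : ℝ) * ((A i)ᴴ * A i).trace.re) _ _
      (fun i => mul_nonneg (Nat.cast_nonneg _) (re_trace_conjTranspose_mul_self_nonneg _)) h2A
      h3A.ge
  have hFB : ∑ i ∈ Finset.univ.filter (fun i => ¬ d i = 1), (d i : ℝ) * ((B i)ᴴ * B i).trace.re ≤
      cG * (T.card * U.card) - ((T.card : ℝ) * U.card) ^ 2 :=
    hrest (fun i => (d i : ℝ) * ((B i)ᴴ * B i).trace.re) _ _
      (fun i => mul_nonneg (Nat.cast_nonneg _) (re_trace_conjTranspose_mul_self_nonneg _)) h2B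
      h3B.ge
  have hFC : ∑ i ∈ Finset.univ.filter (fun i => ¬ d i = 1), (d i : ℝ) * ((C i)ᴴ * C i).trace.re ≤
      cG * (U.card * S.card) - ((U.card : ℝ) * S.card) ^ 2 :=
    hrest (fun i => (d i : ℝ) * ((C i)ᴴ * C i).trace.re) _ _
      (fun i => mul_nonneg (Nat.cast_nonneg _) (re_trace_conjTranspose_mul_self_nonneg _)) h2C
      h3C.ge
  set α : ℝ := cG * (S.card * T.card) - ((S.card : ℝ) * T.card) ^ 2 with hα
  set β : ℝ := cG * (T.card * U.card) - ((T.card : ℝ) * U.card) ^ 2 with hβ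
  set γ : ℝ := cG * (U.card * S.card) - ((U.card : ℝ) * S.card) ^ 2 with hγ
  have hsum0 : ∀ M : ∀ i : Fin r, Matrix (Fin (d i)) (Fin (d i)) ℂ,
      0 ≤ ∑ i ∈ Finset.univ.filter (fun i => ¬ d i = 1), (d i : ℝ) * ((M i)ᴴ * M i).trace.re :=
    fun M => Finset.sum_nonneg fun i _ =>
      mul_nonneg (Nat.cast_nonneg _) (re_trace_conjTranspose_mul_self_nonneg _)
  have hα0 : 0 ≤ α := (hsum0 A).trans hFA
  have hβ0 : 0 ≤ β := (hsum0 B).trans hFB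
  -- (5) blocks of dimension `> 1`
  set K : ℝ := Real.sqrt (α / n) with hK
  have hK0 : 0 ≤ K := Real.sqrt_nonneg _
  have h5 : ∀ i, 1 < d i → (d i : ℝ) * ‖(A i * B i * C i).trace‖ ≤
      K * (Real.sqrt (d i * ((B i)ᴴ * B i).trace.re) *
        Real.sqrt (d i * ((C i)ᴴ * C i).trace.re)) := by
    intro i hi
    have hdi : (0 : ℝ) < d i := by exact_mod_cast (zero_lt_one.trans hi)
    have hnle : n ≤ d i := by
      rw [hn]
      exact_mod_cast (secondCharDegree_le (blockDegree_mem_charDegrees φ i) hi).2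
    have hnpos : 0 < n := by
      rw [hn]
      exact_mod_cast
        (zero_lt_two.trans_le (secondCharDegree_le (blockDegree_mem_charDegrees φ i) hi).1)
    have hiF : i ∈ Finset.univ.filter (fun i => ¬ d i = 1) :=
      Finset.mem_filter.2 ⟨Finset.mem_univ _, by omega⟩
    -- `‖Aᵢ‖² ≤ a(|G| − a) / n`
    have hAi : ((A i)ᴴ * A i).trace.re ≤ α / n := by
      have hle : (d i : ℝ) * ((A i)ᴴ * A i).trace.re ≤ α :=
        (Finset.single_le_sum (f := fun j => (d j : ℝ) * ((A j)ᴴ * A j).trace.re)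
          (fun j _ => mul_nonneg (Nat.cast_nonneg _) (re_trace_conjTranspose_mul_self_nonneg _))
          hiF).trans hFA
      calc ((A i)ᴴ * A i).trace.re ≤ α / d i := by
            rw [le_div_iff₀ hdi, mul_comm]; exact hle
        _ ≤ α / n := div_le_div_of_nonneg_left hα0 hnpos hnle
    calc (d i : ℝ) * ‖(A i * B i * C i).trace‖
        ≤ d i * (Real.sqrt (((A i)ᴴ * A i).trace.re) *
            (Real.sqrt (((B i)ᴴ * B i).trace.re) * Real.sqrt (((C i)ᴴ * C i).trace.re))) :=
          mul_le_mul_of_nonneg_left (norm_trace_mul_mul_le _ _ _) hdi.le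
      _ ≤ d i * (K * (Real.sqrt (((B i)ᴴ * B i).trace.re) *
            Real.sqrt (((C i)ᴴ * C i).trace.re))) :=
          mul_le_mul_of_nonneg_left (mul_le_mul_of_nonneg_right (Real.sqrt_le_sqrt hAi)
            (mul_nonneg (Real.sqrt_nonneg _) (Real.sqrt_nonneg _))) hdi.le
      _ = K * (Real.sqrt (d i * ((B i)ᴴ * B i).trace.re) *
            Real.sqrt (d i * ((C i)ᴴ * C i).trace.re)) := by
          rw [Real.sqrt_mul hdi.le, Real.sqrt_mul hdi.le]
          have := Real.mul_self_sqrt hdi.le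
          linear_combination
            (-(K * Real.sqrt (((B i)ᴴ * B i).trace.re) * Real.sqrt (((C i)ᴴ * C i).trace.re))) *
              this
  -- summing (5) over the blocks of dimension `> 1`, with Cauchy–Schwarz over these blocks only
  have h5sum : ∑ i ∈ Finset.univ.filter (fun i => ¬ d i = 1),
      (d i : ℝ) * ‖(A i * B i * C i).trace‖ ≤ K * (Real.sqrt β * Real.sqrt γ) := by
    have hne1 : ∀ i, ¬ d i = 1 → 1 < d i := fun i hi => by
      have := (hd i).pos
      omega
    calc ∑ i ∈ Finset.univ.filter (fun i => ¬ d i = 1), (d i : ℝ) * ‖(A i * B i * C i).trace‖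
        ≤ ∑ i ∈ Finset.univ.filter (fun i => ¬ d i = 1),
            K * (Real.sqrt (d i * ((B i)ᴴ * B i).trace.re) *
              Real.sqrt (d i * ((C i)ᴴ * C i).trace.re)) :=
          Finset.sum_le_sum fun i hi => h5 i (hne1 i (Finset.mem_filter.1 hi).2)
      _ = K * ∑ i ∈ Finset.univ.filter (fun i => ¬ d i = 1),
            Real.sqrt (d i * ((B i)ᴴ * B i).trace.re) *
              Real.sqrt (d i * ((C i)ᴴ * C i).trace.re) := by
          rw [Finset.mul_sum]
      _ ≤ K * (Real.sqrt (∑ i ∈ Finset.univ.filter (fun i => ¬ d i = 1),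
              (d i : ℝ) * ((B i)ᴴ * B i).trace.re) *
            Real.sqrt (∑ i ∈ Finset.univ.filter (fun i => ¬ d i = 1),
              (d i : ℝ) * ((C i)ᴴ * C i).trace.re)) :=
          mul_le_mul_of_nonneg_left (Real.sum_sqrt_mul_sqrt_le _
            (fun i => mul_nonneg (Nat.cast_nonneg _)
              (re_trace_conjTranspose_mul_self_nonneg _))
            (fun i => mul_nonneg (Nat.cast_nonneg _)
              (re_trace_conjTranspose_mul_self_nonneg _))) hK0
      _ ≤ K * (Real.sqrt β * Real.sqrt γ) :=
          mul_le_mul_of_nonneg_left (mul_le_mul (Real.sqrt_le_sqrt hFB) (Real.sqrt_le_sqrt hFC)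
            (Real.sqrt_nonneg _) (Real.sqrt_nonneg _)) hK0
  -- (6) assemble: `|G| N ≥ N² − E`
  have hsplit := Finset.sum_filter_add_sum_filter_not Finset.univ (fun i => d i = 1)
    (fun i => (d i : ℝ) * (A i * B i * C i).trace.re)
  have hpos : (N : ℝ) ^ 2 ≤ ∑ i ∈ Finset.univ.filter (fun i => d i = 1),
      (d i : ℝ) * (A i * B i * C i).trace.re := by
    rw [← h3]
    exact Finset.single_le_sum (f := fun i => (d i : ℝ) * (A i * B i * C i).trace.re)
      (fun i hi => h4 i (Finset.mem_filter.1 hi).2) (Finset.mem_filter.2 ⟨Finset.mem_univ _, hdi₀⟩)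
  have hneg : -(K * (Real.sqrt β * Real.sqrt γ)) ≤
      ∑ i ∈ Finset.univ.filter (fun i => ¬ d i = 1), (d i : ℝ) * (A i * B i * C i).trace.re := by
    refine (neg_le_neg h5sum).trans ?_
    rw [← Finset.sum_neg_distrib]
    refine Finset.sum_le_sum fun i _ => ?_
    rw [← mul_neg]
    exact mul_le_mul_of_nonneg_left
      ((neg_le_neg (Complex.abs_re_le_norm _)).trans (neg_abs_le _)) (Nat.cast_nonneg _)
  have hmain : (N : ℝ) ^ 2 - K * (Real.sqrt β * Real.sqrt γ) ≤ cG * N := by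
    rw [h1, ← hsplit]
    linarith
  have hmain' : (N : ℝ) * ((N : ℝ) - cG) ≤ K * (Real.sqrt β * Real.sqrt γ) := by
    linear_combination hmain
  -- conclude: `√n E = N √((|G| − a)(|G| − b)(|G| − c))`, then cancel `N > 0`
  have hNpos : (0 : ℝ) < N := by exact_mod_cast Nat.pos_of_ne_zero hN0
  have hn0 : 0 ≤ n := by rw [hn]; exact Nat.cast_nonneg _
  rcases hn0.eq_or_lt with hnz | hnpos
  · rw [← hnz, Real.sqrt_zero, zero_mul]
    exact Real.sqrt_nonneg _
  have hKn : Real.sqrt n * K = Real.sqrt α := by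
    rw [hK, Real.sqrt_div' α hn0, mul_div_assoc']
    exact mul_div_cancel_left₀ _ (Real.sqrt_pos.2 hnpos).ne'
  have hE : Real.sqrt n * (K * (Real.sqrt β * Real.sqrt γ)) =
      N * Real.sqrt ((cG - S.card * T.card) * (cG - T.card * U.card) * (cG - U.card * S.card)) := by
    rw [← mul_assoc, hKn, ← mul_assoc, ← Real.sqrt_mul hα0, ← Real.sqrt_mul (mul_nonneg hα0 hβ0),
      show α * β * γ = (N : ℝ) ^ 2 *
          ((cG - S.card * T.card) * (cG - T.card * U.card) * (cG - U.card * S.card)) by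
        rw [hα, hβ, hγ, hN]; push_cast; ring,
      Real.sqrt_mul (sq_nonneg _), Real.sqrt_sq hNpos.le]
  refine le_of_mul_le_mul_left ?_ hNpos
  calc (N : ℝ) * (Real.sqrt n * ((N : ℝ) - cG)) = Real.sqrt n * ((N : ℝ) * ((N : ℝ) - cG)) := by
        ring
    _ ≤ Real.sqrt n * (K * (Real.sqrt β * Real.sqrt γ)) :=
        mul_le_mul_of_nonneg_left hmain' (Real.sqrt_nonneg _)
    _ = N * Real.sqrt ((cG - S.card * T.card) * (cG - T.card * U.card) * (cG - U.card * S.card)) :=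
        hE

end Summit.MatrixMultiplication.MatrixMultiplication.Theorems.GlobalBranch

end
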